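import Summits.NavierStokesRegularity.TurbBounds.FSU1.Mode.M01Calculus
import Summits.NavierStokesRegularity.TurbBounds.FSU1.Mode.M03Defs

/-!
# FS-U1″ mode lemma — CouplingSlope (`TurbBounds/FSU1/Mode/M08CouplingSlope.lean`)

FS-PROOF-DRAFT §3.7 (i): the slope part of the coupling bound — `couplingSlope : CouplingSlope`.

Cell-made mathematics of FS-PROOF-DRAFT §3 (pub-turb-sos), kernel-checked; generated from the design compose file
`StageF_compose.check.lean` (96c4b9bf…) by `build_mode_split.py`.  HONEST FRAMING: rigorous bounds for the stated PDE and boundary conditions; no claim about physical turbulence beyond the bound.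
-/

open Real intervalIntegral MeasureTheory Set

namespace Summit.NavierStokesRegularity.TurbBounds.FSU1.Mode

open Summit.NavierStokesRegularity.TurbBounds.SpectralFormFreeSlip

/-- The substitution identity: `∫₀^δ (cosh kδ − cosh kz)² dz = δ (kδ)⁴ ‖H_{kδ}‖²`. -/
theorem integral_g_sq (δ k : ℝ) (hδ : 0 < δ) (hk : 0 < k) :
    ∫ z in (0:ℝ)..δ, (Real.cosh (k * δ) - Real.cosh (k * z)) ^ 2 = δ * (k * δ) ^ 4 * HnormSq (k * δ) := by
  have hρ : k * δ ≠ 0 := (mul_pos hk hδ).ne'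
  have hδ0 : δ ≠ 0 := hδ.ne'
  have hsub : ∫ s in (0:ℝ)..1, (Real.cosh (k * δ) - Real.cosh (k * δ * s)) ^ 2
      = δ⁻¹ * ∫ z in (0:ℝ)..δ, (Real.cosh (k * δ) - Real.cosh (k * z)) ^ 2 := by
    have := intervalIntegral.integral_comp_mul_left (a := 0) (b := 1)
      (fun z => (Real.cosh (k * δ) - Real.cosh (k * z)) ^ 2) hδ0
    simpa [mul_assoc] using this
  unfold HnormSq
  have e : (fun s => ((Real.cosh (k * δ) - Real.cosh (k * δ * s)) / (k * δ) ^ 2) ^ 2)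
      = fun s => ((k * δ) ^ 4)⁻¹ * (Real.cosh (k * δ) - Real.cosh (k * δ * s)) ^ 2 := by
    funext s
    have hρ4 : (k * δ) ^ 4 = ((k * δ) ^ 2) ^ 2 := by ring
    rw [hρ4, div_pow, eq_comm, inv_mul_eq_div]
  rw [e, intervalIntegral.integral_const_mul, hsub]
  field_simp

/-- FS-PROOF-DRAFT §3.7 (i), PROVED: `|(1/δ)∫₀^δ (S/k)·sinh(kz)·Θ| ≤ √(δ³‖H_{kδ}‖²)·|S|·‖Θ′‖_{L²(0,δ)}` for `Θ ∈ C¹`, `Θ(0) = 0`. -/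
theorem couplingSlope : CouplingSlope := by
  intro δ k S Θ hδ hk hΘ hΘ0
  have hk0 : k ≠ 0 := hk.ne'
  have hδ0 : δ ≠ 0 := hδ.ne'
  -- derivative facts
  have hΘd : ∀ x, HasDerivAt Θ (deriv Θ x) x := fun x =>
    ((hΘ.differentiable (by simp)).differentiableAt).hasDerivAt
  have hΘ'c : Continuous (deriv Θ) := hΘ.continuous_deriv le_rfl
  set g : ℝ → ℝ := fun z => Real.cosh (k * δ) - Real.cosh (k * z) with hg
  set v : ℝ → ℝ := fun z => (Real.cosh (k * z) - Real.cosh (k * δ)) / k with hv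
  have hvd : ∀ x, HasDerivAt v (Real.sinh (k * x)) x := by
    intro x
    have h1 : HasDerivAt (fun z => k * z) k x := by simpa using (hasDerivAt_id x).const_mul k
    have h2 : HasDerivAt (fun z => Real.cosh (k * z)) (Real.sinh (k * x) * k) x := (Real.hasDerivAt_cosh _).comp x h1
    have h3 := (h2.sub_const (Real.cosh (k * δ))).div_const k
    have e : Real.sinh (k * x) * k / k = Real.sinh (k * x) := by field_simp
    rw [e] at h3
    exact h3
  have hgc : Continuous g := by
    rw [hg]; exact continuous_const.sub (Real.continuous_cosh.comp (continuous_const.mul continuous_id))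
  have hsinhc : Continuous fun x => Real.sinh (k * x) := Real.continuous_sinh.comp (continuous_const.mul continuous_id)
  -- integration by parts: ∫ Θ · sinh(k·) = Θ δ v δ − Θ 0 v 0 − ∫ Θ' v = ∫ Θ' g / k
  have hibp := intervalIntegral.integral_mul_deriv_eq_deriv_mul (a := 0) (b := δ) (u := Θ) (u' := deriv Θ)
    (v := v) (v' := fun x => Real.sinh (k * x)) (fun x _ => hΘd x) (fun x _ => hvd x)
    (hΘ'c.intervalIntegrable _ _) (hsinhc.intervalIntegrable _ _)
  have hvδ : v δ = 0 := by rw [hv]; simp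
  have hI : ∫ z in (0:ℝ)..δ, S / k * Real.sinh (k * z) * Θ z = S / k ^ 2 * ∫ z in (0:ℝ)..δ, deriv Θ z * g z := by
    have e1 : (fun z => S / k * Real.sinh (k * z) * Θ z) = fun z => S / k * (Θ z * Real.sinh (k * z)) := by
      funext z; ring
    rw [e1, intervalIntegral.integral_const_mul, hibp, hvδ, hΘ0]
    have e2 : (fun x => deriv Θ x * v x) = fun x => -(1 / k) * (deriv Θ x * g x) := by
      funext x; rw [hv, hg]; field_simp; ring
    rw [e2, intervalIntegral.integral_const_mul]
    field_simp; ring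
  -- Cauchy–Schwarz
  have hCS := abs_integral_mul_le hδ.le hΘ'c hgc
  have hgsq : ∫ z in (0:ℝ)..δ, g z ^ 2 = δ * (k * δ) ^ 4 * HnormSq (k * δ) := by
    rw [hg]; exact integral_g_sq δ k hδ hk
  have hH0 : 0 ≤ HnormSq (k * δ) := by
    unfold HnormSq; exact intervalIntegral.integral_nonneg zero_le_one (fun s _ => sq_nonneg _)
  -- assemble
  rw [hI]
  have hT0 : 0 ≤ Real.sqrt (∫ z in (0:ℝ)..δ, deriv Θ z ^ 2) := Real.sqrt_nonneg _
  have hkey : Real.sqrt (∫ z in (0:ℝ)..δ, g z ^ 2) = (k * δ) ^ 2 * Real.sqrt (δ * HnormSq (k * δ)) := by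
    rw [hgsq]
    have : δ * (k * δ) ^ 4 * HnormSq (k * δ) = ((k * δ) ^ 2) ^ 2 * (δ * HnormSq (k * δ)) := by ring
    rw [this, Real.sqrt_mul (sq_nonneg _), Real.sqrt_sq (by positivity)]
  have hL : |1 / δ * (S / k ^ 2 * ∫ z in (0:ℝ)..δ, deriv Θ z * g z)|
      = |S| / (δ * k ^ 2) * |∫ z in (0:ℝ)..δ, deriv Θ z * g z| := by
    rw [abs_mul, abs_mul, abs_of_pos (one_div_pos.mpr hδ), abs_div, abs_of_pos (pow_pos hk 2)]
    ring
  rw [hL]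
  have hR : Real.sqrt (δ ^ 3 * HnormSq (k * δ)) * |S| * Real.sqrt (∫ z in (0:ℝ)..δ, deriv Θ z ^ 2)
      = |S| / (δ * k ^ 2) * (Real.sqrt (∫ z in (0:ℝ)..δ, deriv Θ z ^ 2) * Real.sqrt (∫ z in (0:ℝ)..δ, g z ^ 2)) := by
    rw [hkey]
    have : δ ^ 3 * HnormSq (k * δ) = δ ^ 2 * (δ * HnormSq (k * δ)) := by ring
    rw [this, Real.sqrt_mul (sq_nonneg _), Real.sqrt_sq hδ.le]
    field_simp
  rw [hR]
  exact mul_le_mul_of_nonneg_left hCS (by positivity)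

end Summit.NavierStokesRegularity.TurbBounds.FSU1.Mode
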